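import Mathlib.Analysis.SpecialFunctions.Pow.Real
import Mathlib.Analysis.SpecialFunctions.Exponential
import Mathlib.Data.Nat.Factorial.BigOperators
import Mathlib.Data.Nat.Choose.Basic
import HarnessLib

/-!
# Barrier (Schanuel) `EFunctionValuesAtAlgebraicPoints`: factorial asymptotics for Baker Ch. 11 (Lemma 4, §4) — proofs only

`Literature/Barriers/Schanuel/EFunctionValuesAtAlgebraicPointsAsymptotics.lean` — sibling file of
`EFunctionValuesAtAlgebraicPoints.lean` in the programme to discharge `siegelShidlovskii_algIndep`
(Siegel–Shidlovskii; Rivoal Thm. 5.10 = Baker Thm. 11.1). The elementary comparisons against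
powers of `r!` that Baker, *Transcendental Number Theory*, Ch. 11 uses silently in the proofs of
Lemma 4 and of Theorem 11.1 (pp. 112–114: "`h! ≤ (r!)^{3ε}`", "`M! ≥ (2nr)^{-εr}(r!)ⁿ ≥
(r!)^{n−3ε}`", "if `r` is sufficiently large"):

* `SiegelShidlovskii.pow_self_le_factorial_sq` — `rʳ ≤ (r!)²`, hence `r^{x r} ≤ (r!)^{2x}`
  (`rpow_self_mul_le_factorial_rpow`);
* `SiegelShidlovskii.exists_pow_le_factorial_rpow` — `Bʳ ≤ (r!)^ε` for `r ≫ 1`, and the master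
  absorption `Bʳ (r+1)ᶜ ≤ (r!)^δ` (`exists_pow_mul_pow_le_factorial_rpow`);
* `SiegelShidlovskii.factorial_pow_le_factorial_mul` — `(r!)^ν ≤ (νr)!`;
  `factorial_le_pow_mul_factorial` — `N! ≤ N^{N−L} L!`;
* `SiegelShidlovskii.tsum_tail_exp_le` — `∑_{k} x^{L+k}/(L+k)! ≤ (x^L/L!) eˣ` for `x ≥ 0`.

All [folklore]; no named facts.

## References

* A. Baker, *Transcendental Number Theory*, CUP 1975, Ch. 11 §3–§4 (pp. 112–114).
-/

noncomputable section

open Finset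
open scoped Nat

namespace Literature.Barriers.Schanuel

namespace SiegelShidlovskii

/-! ### 1. `rʳ ≤ (r!)²` -/

/-- **`rʳ ≤ (r!)²`** (pair the factors `k` and `r + 1 − k`: `k(r+1−k) ≥ r`). [folklore] -/
theorem pow_self_le_factorial_sq (r : ℕ) : r ^ r ≤ (r !) ^ 2 := by
  have h1 : r ! = ∏ i ∈ range r, (i + 1) := Nat.factorial_eq_prod_range_add_one r
  have h2 : r ! = ∏ i ∈ range r, (r - i) := by
    rw [h1, ← prod_range_reflect (fun i => i + 1) r]
    refine prod_congr rfl fun i hi => ?_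
    have := mem_range.mp hi
    omega
  calc r ^ r = ∏ _i ∈ range r, r := by rw [prod_const, card_range]
    _ ≤ ∏ i ∈ range r, (i + 1) * (r - i) := by
        refine prod_le_prod (fun i _ => Nat.zero_le _) fun i hi => ?_
        have hi' := mem_range.mp hi
        -- `(i+1)(r-i) - r = i (r - i - 1) ≥ 0`
        obtain ⟨d, rfl⟩ := Nat.exists_eq_add_of_lt hi'
        rw [show i + d + 1 - i = d + 1 by omega]
        nlinarith
    _ = (r !) ^ 2 := by rw [prod_mul_distrib, ← h1, ← h2, sq]

/-- Real form: `(r : ℝ)^{x r} ≤ (r!)^{2x}` for `x ≥ 0`. [folklore] -/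
theorem rpow_self_mul_le_factorial_rpow {x : ℝ} (hx : 0 ≤ x) (r : ℕ) :
    (r : ℝ) ^ (x * r) ≤ ((r ! : ℕ) : ℝ) ^ (2 * x) := by
  have h := pow_self_le_factorial_sq r
  have h' : ((r : ℝ) ^ r) ≤ ((r ! : ℕ) : ℝ) ^ 2 := by exact_mod_cast h
  calc (r : ℝ) ^ (x * r) = ((r : ℝ) ^ (r : ℝ)) ^ x := by
        rw [← Real.rpow_mul (Nat.cast_nonneg _), mul_comm]
    _ = ((r : ℝ) ^ r) ^ x := by rw [Real.rpow_natCast]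
    _ ≤ (((r ! : ℕ) : ℝ) ^ 2) ^ x := Real.rpow_le_rpow (by positivity) h' hx
    _ = ((r ! : ℕ) : ℝ) ^ (2 * x) := by
        rw [← Real.rpow_natCast, ← Real.rpow_mul (Nat.cast_nonneg _)]
        norm_num

/-! ### 2. Geometric and polynomial factors are `(r!)^ε` -/

/-- `(k+1)^{r-k} ≤ r!` for `k ≤ r`. [folklore] -/
theorem pow_sub_le_factorial {k r : ℕ} (hk : k ≤ r) : (k + 1) ^ (r - k) ≤ r ! := by
  have h := @Nat.factorial_mul_pow_le_factorial k (r - k)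
  rw [Nat.add_sub_cancel' hk] at h
  exact le_trans (Nat.le_mul_of_pos_left _ (Nat.factorial_pos k)) h

/-- **`Bʳ ≤ (r!)^ε` for `r ≫ 1`** (`B ≥ 1`, `ε > 0`). [folklore] -/
theorem exists_pow_le_factorial_rpow {B : ℝ} (hB : 1 ≤ B) {ε : ℝ} (hε : 0 < ε) :
    ∃ r₀ : ℕ, ∀ r : ℕ, r₀ ≤ r → B ^ r ≤ ((r ! : ℕ) : ℝ) ^ ε := by
  -- choose `k` with `(k+1)^ε ≥ B²`
  obtain ⟨k, hk⟩ := exists_nat_ge (B ^ (2 / ε))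
  refine ⟨2 * k, fun r hr => ?_⟩
  have hkr : k ≤ r := by omega
  have hB0 : 0 ≤ B := le_trans zero_le_one hB
  have h1 : ((k + 1 : ℕ) : ℝ) ^ ((r - k : ℕ) : ℝ) ≤ ((r ! : ℕ) : ℝ) := by
    rw [Real.rpow_natCast]
    exact_mod_cast pow_sub_le_factorial hkr
  have h2 : B ^ (2 / ε) ≤ ((k + 1 : ℕ) : ℝ) := hk.trans (by push_cast; linarith)
  have hk1 : (0 : ℝ) ≤ ((k + 1 : ℕ) : ℝ) := Nat.cast_nonneg _
  calc B ^ r = B ^ (r : ℝ) := (Real.rpow_natCast B r).symm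
    _ ≤ B ^ ((2 : ℝ) * ((r - k : ℕ) : ℝ)) := by
        refine Real.rpow_le_rpow_of_exponent_le hB ?_
        have : ((r - k : ℕ) : ℝ) = (r : ℝ) - k := by rw [Nat.cast_sub hkr]
        rw [this]
        have : ((2 * k : ℕ) : ℝ) ≤ r := by exact_mod_cast hr
        push_cast at this
        linarith
    _ = (B ^ (2 / ε)) ^ (ε * ((r - k : ℕ) : ℝ)) := by
        rw [← Real.rpow_mul hB0]
        congr 1
        field_simp
    _ ≤ (((k + 1 : ℕ) : ℝ)) ^ (ε * ((r - k : ℕ) : ℝ)) :=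
        Real.rpow_le_rpow (by positivity) h2 (by positivity)
    _ = ((((k + 1 : ℕ) : ℝ)) ^ ((r - k : ℕ) : ℝ)) ^ ε := by
        rw [← Real.rpow_mul hk1, mul_comm]
    _ ≤ ((r ! : ℕ) : ℝ) ^ ε := Real.rpow_le_rpow (by positivity) h1 hε.le

/-- `(r+1)ᶜ ≤ (2ᶜ)ʳ`. [folklore] -/
theorem succ_pow_le_two_pow_pow (r c : ℕ) : ((r : ℝ) + 1) ^ c ≤ ((2 : ℝ) ^ c) ^ r := by
  have h : r + 1 ≤ 2 ^ r := r.lt_two_pow_self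
  calc ((r : ℝ) + 1) ^ c ≤ ((2 : ℝ) ^ r) ^ c := by
        refine pow_le_pow_left₀ (by positivity) ?_ c
        exact_mod_cast h
    _ = ((2 : ℝ) ^ c) ^ r := by rw [← pow_mul, ← pow_mul, mul_comm]

/-- **Master absorption**: `Bʳ (r+1)ᶜ ≤ (r!)^δ` for `r ≫ 1` (`B ≥ 1`, `δ > 0`). [folklore] -/
theorem exists_pow_mul_pow_le_factorial_rpow {B : ℝ} (hB : 1 ≤ B) (c : ℕ) {δ : ℝ} (hδ : 0 < δ) :
    ∃ r₀ : ℕ, ∀ r : ℕ, r₀ ≤ r → B ^ r * ((r : ℝ) + 1) ^ c ≤ ((r ! : ℕ) : ℝ) ^ δ := by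
  obtain ⟨r₀, hr₀⟩ := exists_pow_le_factorial_rpow (B := B * 2 ^ c)
    (le_trans hB (le_mul_of_one_le_right (le_trans zero_le_one hB) (one_le_pow₀ (by norm_num)))) hδ
  refine ⟨r₀, fun r hr => le_trans ?_ (hr₀ r hr)⟩
  rw [mul_pow]
  exact mul_le_mul_of_nonneg_left (succ_pow_le_two_pow_pow r c) (pow_nonneg (le_trans zero_le_one hB) _)

/-! ### 3. Factorials of multiples and quotients of factorials -/

/-- `m! n! ≤ (m+n)!`. [folklore] -/
theorem factorial_mul_factorial_le (m n : ℕ) : m ! * n ! ≤ (m + n)! :=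
  Nat.le_of_dvd (Nat.factorial_pos _) (Nat.factorial_mul_factorial_dvd_factorial_add m n)

/-- **`(r!)^ν ≤ (νr)!`.** [folklore] -/
theorem factorial_pow_le_factorial_mul (ν r : ℕ) : (r !) ^ ν ≤ (ν * r)! := by
  induction ν with
  | zero => simp
  | succ ν ih =>
    calc (r !) ^ (ν + 1) = (r !) ^ ν * r ! := pow_succ _ _
      _ ≤ (ν * r)! * r ! := Nat.mul_le_mul_right _ ih
      _ ≤ (ν * r + r)! := factorial_mul_factorial_le _ _
      _ = ((ν + 1) * r)! := by rw [Nat.succ_mul]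

/-- **`N! ≤ N^{N−L} · L!`** for `L ≤ N`. [folklore] -/
theorem factorial_le_pow_mul_factorial {L N : ℕ} (h : L ≤ N) : N ! ≤ N ^ (N - L) * L ! := by
  have h1 := Nat.factorial_mul_descFactorial (Nat.sub_le N L)
  rw [Nat.sub_sub_self h] at h1
  rw [← h1, mul_comm]
  exact Nat.mul_le_mul_right _ (Nat.descFactorial_le_pow N (N - L))

/-! ### 4. The tail of the exponential series -/

/-- `x^{L+k}/(L+k)! ≤ (x^L/L!) (x^k/k!)` for `x ≥ 0`. [folklore] -/
theorem pow_div_factorial_add_le {x : ℝ} (hx : 0 ≤ x) (L k : ℕ) :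
    x ^ (L + k) / ((L + k)! : ℝ) ≤ x ^ L / (L ! : ℝ) * (x ^ k / (k ! : ℝ)) := by
  rw [div_mul_div_comm, ← pow_add]
  refine div_le_div_of_nonneg_left (pow_nonneg hx _) (by positivity) ?_
  exact_mod_cast factorial_mul_factorial_le L k

/-- The shifted exponential series is summable. [folklore] -/
theorem summable_pow_div_factorial_add (x : ℝ) (L : ℕ) :
    Summable fun k : ℕ => x ^ (L + k) / ((L + k)! : ℝ) := by
  have h := (Real.summable_pow_div_factorial x)
  exact (summable_nat_add_iff L).mpr h |>.congr fun k => by rw [add_comm]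

/-- **Tail of the exponential series**: `∑ₖ x^{L+k}/(L+k)! ≤ (x^L/L!)·eˣ` for `x ≥ 0`.
[folklore] -/
theorem tsum_tail_exp_le {x : ℝ} (hx : 0 ≤ x) (L : ℕ) :
    ∑' k : ℕ, x ^ (L + k) / ((L + k)! : ℝ) ≤ x ^ L / (L ! : ℝ) * Real.exp x := by
  have hexp : HasSum (fun k : ℕ => x ^ k / (k ! : ℝ)) (Real.exp x) := by
    rw [Real.exp_eq_exp_ℝ]
    exact NormedSpace.expSeries_div_hasSum_exp x
  have h2 : HasSum (fun k : ℕ => x ^ L / (L ! : ℝ) * (x ^ k / (k ! : ℝ)))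
      (x ^ L / (L ! : ℝ) * Real.exp x) := hexp.mul_left _
  refine le_trans ((summable_pow_div_factorial_add x L).tsum_le_tsum
    (fun k => pow_div_factorial_add_le hx L k) h2.summable) (le_of_eq h2.tsum_eq)

end SiegelShidlovskii

end Literature.Barriers.Schanuel

end
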